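import Summits.CriticalPhenomena.Ising3DConformalLimit.Theorems.LogPolarProxyProxyUniversalityDefs
import Summits.CriticalPhenomena.Ising3DConformalLimit.Theorems.LogPolarProxyProxyUniversalityScalingLimitRigidity
import Summits.CriticalPhenomena.Ising3DConformalLimit.Theorems.LogPolarProxyProxyUniversalityLimitLocallyBounded
import Summits.CriticalPhenomena.Ising3DConformalLimit.Theorems.LogPolarProxyProxyUniversalitySlices
import HarnessLib

/-!
# Crux `ProxyUniversality` (stmt-CriticalPhenomena-11288), line `registered` — the REDUCTION:
# gauge transfer, and `ProxyUniversality ⟺ one-gauge realisation ⟺ even-order one-gauge realisation`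

Route `LogPolarProxy`, sub-problem `Ising3DConformalLimit`; skeleton `Cruxes/ProxyUniversality/Lines/birth.lean`
(v3, lead `prover-line-stmt-CriticalPhenomena-11288-0`). This file is the sorry-free GLUE of the line, landed so
that the reduction of the crux to its one remaining open stub is importable (by the crux's disprover, by
ideation, and by the closing file):

* `proxyRealises_transfer` — **the engine**: if the proxy renormalised by `ρ₀` realises `T₀` locally uniformly on
  `offAxis n`, `ρ/ρ₀ → c` as `δ → 0⁺`, `T = cⁿ T₀` on `offAxis n` and `T₀` is locally bounded there, then the
  proxy renormalised by `ρ` — SAME profiles, SAME amplitudes — realises `T`: the two renormalised correlators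
  differ by `∏ᵢ (ρ/ρ₀)(δ_N‖pᵢ‖)`, eventually in `N` and locally in `p`, and that factor `→ cⁿ` locally uniformly
  (`tendsto_mesh`, `tendstoLocallyUniformlyOn_ratio`, `TendstoLocallyUniformlyOn.mul₀_of_isBoundedUnder`);
* `namedForm_of_oneGauge` — with the landed S2 (`stub_scalingLimitRigidity`: two non-degenerate limit pairs
  differ by one positive scale, `ρ/ρ₀ → c`) and S3 (`stub_limitLocallyBounded`), realising ONE limit pair
  realises EVERY limit pair;
* `ProxyUniversality_iff_oneGauge` — **crux ⟺ S1** (the planner's one-gauge statement, v1 stub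
  `stub_proxyRealisesOneLimit`);
* `ProxyUniversality_iff_evenLimit` — **crux ⟺ S1'** (the v2 open stub `stub_proxyRealisesEvenLimit`: even
  orders `n ≠ 0` only), using the landed universal slices Z `stub_proxySliceZero` (`n = 0`) and O
  `stub_proxySliceOdd` (odd `n`). This is the registered glue sub-goal this file lands.

So after this file the crux `ProxyUniversality` stands reduced, with nothing lost, to ONE typed open statement:
the finite log-polar proxy, with some row-wise profiles and amplitudes, realises the EVEN orders of ONE
non-degenerate pointwise scaling limit of the critical `ℤ³` correlators — the lattice → lattice universality
content of the route (BrowerFlemingNeuberger2013; arXiv:2006.15636). No definitions are introduced; elementary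
limit algebra over Mathlib's `TendstoLocallyUniformlyOn`.
-/

noncomputable section

namespace Summit.CriticalPhenomena.Ising3DConformalLimit.Cruxes.ProxyUniversality.Birth

open scoped BigOperators Topology
open Filter Set Function
open Literature.Probability.LatticeModels
open Summit.CriticalPhenomena.Ising3DConformalLimit.Theses.LogPolarProxy (ProxyUniversality)

/-! ## Gauge transfer -/

/-- The local mesh `δ_N ‖yᵢ‖ → 0⁺` along `atTop ×ˢ 𝓝[offAxis n] x`. -/
theorem tendsto_mesh {n : ℕ} (x : Fin n → EuclideanSpace ℝ (Fin 3)) (i : Fin n) :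
    Tendsto (fun q : ℕ × (Fin n → EuclideanSpace ℝ (Fin 3)) => Real.pi / ((q.1 : ℝ) + 1) * ‖q.2 i‖)
      (atTop ×ˢ 𝓝[offAxis n] x) (𝓝[>] (0:ℝ)) := by
  have h1 : Tendsto (fun N : ℕ => Real.pi / ((N : ℝ) + 1)) atTop (𝓝 0) := by
    have := tendsto_one_div_add_atTop_nhds_zero_nat.const_mul Real.pi
    rw [mul_zero] at this
    exact this.congr fun N => mul_one_div Real.pi ((N : ℝ) + 1)
  have h2 : Tendsto (fun p : Fin n → EuclideanSpace ℝ (Fin 3) => ‖p i‖) (𝓝[offAxis n] x)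
      (𝓝 ‖x i‖) :=
    ((continuous_apply i).norm.tendsto x).mono_left nhdsWithin_le_nhds
  have h0 : Tendsto (fun q : ℕ × (Fin n → EuclideanSpace ℝ (Fin 3)) =>
      Real.pi / ((q.1 : ℝ) + 1) * ‖q.2 i‖) (atTop ×ˢ 𝓝[offAxis n] x) (𝓝 0) := by
    have := (h1.comp tendsto_fst).mul (h2.comp tendsto_snd)
    simpa using this
  refine tendsto_nhdsWithin_iff.2 ⟨h0, ?_⟩
  have hmem : ∀ᶠ q : ℕ × (Fin n → EuclideanSpace ℝ (Fin 3)) in atTop ×ˢ 𝓝[offAxis n] x,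
      q.2 ∈ offAxis n := tendsto_snd.eventually eventually_mem_nhdsWithin
  filter_upwards [hmem] with q hq
  exact mul_pos (div_pos Real.pi_pos (Nat.cast_add_one_pos _)) (norm_pos_of_mem_offAxis hq i)

/-- The ratio of the two local renormalisations tends to `cⁿ`, locally uniformly off the axis. -/
theorem tendstoLocallyUniformlyOn_ratio {n : ℕ} {ρ ρ₀ : ℝ → ℝ} {c : ℝ}
    (hratio : Tendsto (fun δ : ℝ => ρ δ / ρ₀ δ) (𝓝[>] (0:ℝ)) (𝓝 c)) :
    TendstoLocallyUniformlyOn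
      (fun (N : ℕ) (p : Fin n → EuclideanSpace ℝ (Fin 3)) =>
        ∏ i : Fin n, ρ (Real.pi / (N + 1) * ‖p i‖) / ρ₀ (Real.pi / (N + 1) * ‖p i‖))
      (fun _ => c ^ n) atTop (offAxis n) := by
  rw [tendstoLocallyUniformlyOn_iff_forall_tendsto]
  intro x hx
  have key : Tendsto (fun q : ℕ × (Fin n → EuclideanSpace ℝ (Fin 3)) =>
      ∏ i : Fin n, ρ (Real.pi / ((q.1 : ℝ) + 1) * ‖q.2 i‖) / ρ₀ (Real.pi / ((q.1 : ℝ) + 1) * ‖q.2 i‖))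
      (atTop ×ˢ 𝓝[offAxis n] x) (𝓝 (c ^ n)) := by
    have h : ∀ i : Fin n, Tendsto (fun q : ℕ × (Fin n → EuclideanSpace ℝ (Fin 3)) =>
        ρ (Real.pi / ((q.1 : ℝ) + 1) * ‖q.2 i‖) / ρ₀ (Real.pi / ((q.1 : ℝ) + 1) * ‖q.2 i‖))
        (atTop ×ˢ 𝓝[offAxis n] x) (𝓝 c) := fun i => hratio.comp (tendsto_mesh x i)
    have := tendsto_finsetProd (Finset.univ : Finset (Fin n)) fun i _ => h i
    simpa [Finset.prod_const, Finset.card_univ, Fintype.card_fin] using this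
  exact Uniform.tendsto_nhds_right.1 key

/-- Elementary: `r / b · (a · b) = a · r` for `b ≠ 0`. -/
theorem div_mul_mul_cancel_aux (a b r : ℝ) (hb : b ≠ 0) : r / b * (a * b) = a * r := by
  rw [div_mul_eq_mul_div, mul_div_assoc, mul_div_cancel_right₀ _ hb, mul_comm]

/-- **Transfer lemma** (the engine of the composition): if the proxy renormalised by `ρ₀` realises `T₀`
(locally uniformly on `offAxis n`), `ρ/ρ₀ → c` as `δ → 0⁺`, `T = cⁿ T₀` on `offAxis n` and `T₀` is locally
bounded there, then the proxy renormalised by `ρ` (same profiles, same amplitudes) realises `T`. The two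
renormalised correlators differ by the factor `∏ᵢ (ρ/ρ₀)(δ_N‖pᵢ‖)`, eventually in `N` and locally in `p`
(as soon as every local mesh `δ_N‖pᵢ‖` is in `(0,1]`), and that factor tends to `cⁿ` locally uniformly. -/
theorem proxyRealises_transfer {n : ℕ} {Jr Jt Jp : ℕ → ℕ → ℝ} {A : ℕ → ℝ → ℝ} {ρ ρ₀ : ℝ → ℝ}
    {c : ℝ} {T T₀ : (Fin n → EuclideanSpace ℝ (Fin 3)) → ℝ}
    (hρ₀ : ∀ δ ∈ Set.Ioc (0:ℝ) 1, 0 < ρ₀ δ)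
    (hratio : Tendsto (fun δ : ℝ => ρ δ / ρ₀ δ) (𝓝[>] (0:ℝ)) (𝓝 c))
    (hT : ∀ p ∈ offAxis n, T p = c ^ n * T₀ p)
    (hbdd : ∀ x ∈ offAxis n, ∃ C : ℝ, ∀ᶠ y in 𝓝 x, |T₀ y| ≤ C)
    (hconv : TendstoLocallyUniformlyOn (fun N : ℕ => proxyCorr Jr Jt Jp A ρ₀ N n) T₀ atTop
      (offAxis n)) :
    TendstoLocallyUniformlyOn (fun N : ℕ => proxyCorr Jr Jt Jp A ρ N n) T atTop (offAxis n) := by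
  -- product of two locally uniformly convergent sequences with locally bounded limits
  have hprod := (tendstoLocallyUniformlyOn_ratio (n := n) hratio).mul₀_of_isBoundedUnder hconv
    (fun x _ => isBoundedUnder_const) (fun x hx => by
      obtain ⟨C, hC⟩ := hbdd x hx
      exact ⟨C, (hC.filter_mono nhdsWithin_le_nhds).mono fun y hy => by
        simpa [Real.dist_eq] using hy⟩)
  -- the limit function: `cⁿ · T₀ = T` on `offAxis n`
  replace hprod := hprod.congr_right (g := T) fun p hp => by simp [hT p hp]
  -- the sequence: `ratio · proxyCorr ρ₀ = proxyCorr ρ`, eventually in `N` and locally in `p`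
  rw [tendstoLocallyUniformlyOn_iff_forall_tendsto] at hprod ⊢
  intro x hx
  refine (hprod x hx).congr' ?_
  have hmem : ∀ᶠ q : ℕ × (Fin n → EuclideanSpace ℝ (Fin 3)) in atTop ×ˢ 𝓝[offAxis n] x,
      q.2 ∈ offAxis n := tendsto_snd.eventually eventually_mem_nhdsWithin
  have hsmall : ∀ᶠ q : ℕ × (Fin n → EuclideanSpace ℝ (Fin 3)) in atTop ×ˢ 𝓝[offAxis n] x,
      ∀ i : Fin n, Real.pi / ((q.1 : ℝ) + 1) * ‖q.2 i‖ < 1 :=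
    eventually_all.2 fun i =>
      (tendsto_nhdsWithin_iff.1 (tendsto_mesh x i)).1.eventually (Iio_mem_nhds one_pos)
  filter_upwards [hmem, hsmall] with q hq hs
  refine Prod.ext rfl ?_
  change (∏ i : Fin n, ρ (Real.pi / ((q.1 : ℝ) + 1) * ‖q.2 i‖) / ρ₀ (Real.pi / ((q.1 : ℝ) + 1) * ‖q.2 i‖)) *
      (weight A ρ₀ q.1 n q.2 * proxyAvg Jr Jt Jp q.1 n q.2) =
    weight A ρ q.1 n q.2 * proxyAvg Jr Jt Jp q.1 n q.2
  rw [← mul_assoc]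
  congr 1
  unfold weight
  rw [← Finset.prod_mul_distrib]
  refine Finset.prod_congr rfl fun i _ => ?_
  have hpos : 0 < ρ₀ (Real.pi / ((q.1 : ℝ) + 1) * ‖q.2 i‖) :=
    hρ₀ _ ⟨mul_pos (div_pos Real.pi_pos (Nat.cast_add_one_pos _)) (norm_pos_of_mem_offAxis hq i),
      (hs i).le⟩
  exact div_mul_mul_cancel_aux _ _ _ hpos.ne'

/-! ## The reduction of the crux -/

/-- **S1 → the named form of the crux** (uses the landed S2, S3): realising ONE non-degenerate limit pair
`(ρ₀, S₀)` realises every non-degenerate limit pair `(ρ, S)` with the SAME profiles and amplitudes — S2 gives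
`c` with `ρ/ρ₀ → c` and `S n = cⁿ S₀ n` on `NonCoincident`, S3 the local bounds on `S₀ n`, and
`proxyRealises_transfer` moves the convergence. -/
theorem namedForm_of_oneGauge
    (h1 : ∀ (ρ : ℝ → ℝ) (S : CorrFamily 3), (∀ δ ∈ Set.Ioc (0:ℝ) 1, 0 < ρ δ) →
        HasPointwiseScalingLimit (criticalCorr 3) ρ S → IsNondegenerateTwoPoint S →
        ∃ (ρ₀ : ℝ → ℝ) (S₀ : CorrFamily 3), (∀ δ ∈ Set.Ioc (0:ℝ) 1, 0 < ρ₀ δ) ∧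
          HasPointwiseScalingLimit (criticalCorr 3) ρ₀ S₀ ∧ IsNondegenerateTwoPoint S₀ ∧
          ∃ (Jr Jt Jp : ℕ → ℕ → ℝ) (A : ℕ → ℝ → ℝ), (∀ N j, 0 ≤ Jr N j ∧ 0 ≤ Jt N j ∧ 0 ≤ Jp N j) ∧
            (∀ N θ, 0 < A N θ) ∧
            ∀ n : ℕ, TendstoLocallyUniformlyOn (fun N : ℕ => proxyCorr Jr Jt Jp A ρ₀ N n) (S₀ n) atTop
              (offAxis n)) :
    ∀ (ρ : ℝ → ℝ) (S : CorrFamily 3), (∀ δ ∈ Set.Ioc (0:ℝ) 1, 0 < ρ δ) →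
      HasPointwiseScalingLimit (criticalCorr 3) ρ S → IsNondegenerateTwoPoint S →
      ∃ (Jr Jt Jp : ℕ → ℕ → ℝ) (A : ℕ → ℝ → ℝ), (∀ N j, 0 ≤ Jr N j ∧ 0 ≤ Jt N j ∧ 0 ≤ Jp N j) ∧
        (∀ N θ, 0 < A N θ) ∧
        ∀ n : ℕ, TendstoLocallyUniformlyOn (fun N : ℕ => proxyCorr Jr Jt Jp A ρ N n) (S n) atTop
          (offAxis n) := by
  intro ρ S hρ hlim hnd
  obtain ⟨ρ₀, S₀, hρ₀, hlim₀, hnd₀, Jr, Jt, Jp, A, hJ, hA, hconv⟩ := h1 ρ S hρ hlim hnd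
  obtain ⟨c, -, hratio, hS⟩ := stub_scalingLimitRigidity ρ ρ₀ S S₀ hρ hρ₀ hlim hlim₀ hnd hnd₀
  exact ⟨Jr, Jt, Jp, A, hJ, hA, fun n =>
    proxyRealises_transfer hρ₀ hratio (fun p hp => hS n p hp.1)
      (fun x hx => stub_limitLocallyBounded ρ₀ S₀ hlim₀ n x hx.1) (hconv n)⟩

/-- **The crux ⟺ S1 (one-gauge realisation).** `ProxyUniversality` holds iff, given that `criticalCorr 3`
has a non-degenerate pointwise scaling limit at all, the proxy realises SOME non-degenerate limit pair
`(ρ₀, S₀)` at every order (`→`: take `(ρ₀, S₀) := (ρ, S)`; `←`: `namedForm_of_oneGauge`). -/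
theorem ProxyUniversality_iff_oneGauge :
    ProxyUniversality ↔
      ∀ (ρ : ℝ → ℝ) (S : CorrFamily 3), (∀ δ ∈ Set.Ioc (0:ℝ) 1, 0 < ρ δ) →
        HasPointwiseScalingLimit (criticalCorr 3) ρ S → IsNondegenerateTwoPoint S →
        ∃ (ρ₀ : ℝ → ℝ) (S₀ : CorrFamily 3), (∀ δ ∈ Set.Ioc (0:ℝ) 1, 0 < ρ₀ δ) ∧
          HasPointwiseScalingLimit (criticalCorr 3) ρ₀ S₀ ∧ IsNondegenerateTwoPoint S₀ ∧
          ∃ (Jr Jt Jp : ℕ → ℕ → ℝ) (A : ℕ → ℝ → ℝ), (∀ N j, 0 ≤ Jr N j ∧ 0 ≤ Jt N j ∧ 0 ≤ Jp N j) ∧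
            (∀ N θ, 0 < A N θ) ∧
            ∀ n : ℕ, TendstoLocallyUniformlyOn (fun N : ℕ => proxyCorr Jr Jt Jp A ρ₀ N n) (S₀ n) atTop
              (offAxis n) := by
  refine ⟨fun h ρ S hρ hlim hnd => ?_, fun h1 => proxyUniversality_iff.2 (namedForm_of_oneGauge h1)⟩
  exact ⟨ρ, S, hρ, hlim, hnd, proxyUniversality_iff.1 h ρ S hρ hlim hnd⟩

/-- **The crux ⟺ S1' (even-order one-gauge realisation)** — the registered glue sub-goal of skeleton v3:
`ProxyUniversality` holds iff, given that `criticalCorr 3` has a non-degenerate pointwise scaling limit at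
all, the proxy realises the EVEN orders `n ≠ 0` of SOME non-degenerate limit pair. (`→`: take
`(ρ₀, S₀) := (ρ, S)` and forget the other orders; `←`: the orders `n = 0` and odd `n` hold for every profile
by the landed slices `stub_proxySliceZero`, `stub_proxySliceOdd`, then `ProxyUniversality_iff_oneGauge`.) -/
theorem ProxyUniversality_iff_evenLimit :
    ProxyUniversality ↔
      ∀ (ρ : ℝ → ℝ) (S : CorrFamily 3), (∀ δ ∈ Set.Ioc (0:ℝ) 1, 0 < ρ δ) →
        HasPointwiseScalingLimit (criticalCorr 3) ρ S → IsNondegenerateTwoPoint S →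
        ∃ (ρ₀ : ℝ → ℝ) (S₀ : CorrFamily 3), (∀ δ ∈ Set.Ioc (0:ℝ) 1, 0 < ρ₀ δ) ∧
          HasPointwiseScalingLimit (criticalCorr 3) ρ₀ S₀ ∧ IsNondegenerateTwoPoint S₀ ∧
          ∃ (Jr Jt Jp : ℕ → ℕ → ℝ) (A : ℕ → ℝ → ℝ), (∀ N j, 0 ≤ Jr N j ∧ 0 ≤ Jt N j ∧ 0 ≤ Jp N j) ∧
            (∀ N θ, 0 < A N θ) ∧
            ∀ n : ℕ, Even n → n ≠ 0 →
              TendstoLocallyUniformlyOn (fun N : ℕ => proxyCorr Jr Jt Jp A ρ₀ N n) (S₀ n) atTop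
                (offAxis n) := by
  constructor
  · intro h ρ S hρ hlim hnd
    obtain ⟨Jr, Jt, Jp, A, hJ, hA, hconv⟩ := proxyUniversality_iff.1 h ρ S hρ hlim hnd
    exact ⟨ρ, S, hρ, hlim, hnd, Jr, Jt, Jp, A, hJ, hA, fun n _ _ => hconv n⟩
  · intro hE
    refine ProxyUniversality_iff_oneGauge.2 fun ρ S hρ hlim hnd => ?_
    obtain ⟨ρ₀, S₀, hρ₀, hlim₀, hnd₀, Jr, Jt, Jp, A, hJ, hA, hconv⟩ := hE ρ S hρ hlim hnd
    refine ⟨ρ₀, S₀, hρ₀, hlim₀, hnd₀, Jr, Jt, Jp, A, hJ, hA, fun n => ?_⟩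
    rcases Nat.even_or_odd n with he | ho
    · rcases eq_or_ne n 0 with rfl | hn0
      · exact stub_proxySliceZero Jr Jt Jp A ρ₀ S₀ hlim₀
      · exact hconv n he hn0
    · exact stub_proxySliceOdd Jr Jt Jp A ρ₀ S₀ hlim₀ n ho

end Summit.CriticalPhenomena.Ising3DConformalLimit.Cruxes.ProxyUniversality.Birth

end
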